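import Mathlib

/-!
# StrengthenSmearedTransport — the monotone class-expressible smear on the causal diamond (lens «strengthen», g5, MEMO-08)

Evidence-class kernel file for crux `BlochSeedDiscOne` (stmt-HodgeConjecture-18881).  NOTHING here is a theorem toward
HC / HC_AV / № 4 / 26512 / 18881 / H2: these are letter-calculus facts about the model of record (pad-4 μ₄-designs on the
causal diamond `◇_h`), supporting `STRENGTHEN-MEMO-08-ERRATUM-CAUSAL-DIAMOND-SMEARED-TRANSPORT.md`.

## Dictionary (MEMO-08 §2; the causal-order language is already in `B1OddTowerLaws.lean` §14.1)
An AXIAL letter of `◇_h` is `ℓ = (a, β)`, `β = b·ζ` (`ζ ∈ μ₄`, `b = |β| ≥ 0`), `|β| ≤ a`, `a + |β| ≤ h`.  Co-height `C := h − a`,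
top deficit `d := C − b = 2s` (`s ∈ ℕ`; `ℓ ∈ LINE_{h−2s}`), `Q := C² − b² = 4 s (s + b)` (the `p`-coefficient of the twisted class
vector `φ(ℓ − hI) = (1, −C, β, β̄, Q)`).  A pair (lower `ℓ`, upper `ℓ′`) is LIVE (a non-zero map `O(ℓ) → O(ℓ′)` exists in the model of
record, `padclass.live`) iff `ℓ′ − ℓ` lies in the causal cone `{Δa ≥ |Δβ|}`; in the coordinates `(s, b, ζ)` and with `m := s − s′`
this reads (MEMO-08 §2(c)):
* same phase (or one of the two letters phase-less):            `s′ ≤ s ∧ b′ ≤ b + m`           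
* opposite phases (`ζ′ = −ζ`, `b, b′ ≥ 1`), and lower phase-less: `b′ ≤ m`                       
* orthogonal phases (`ζ′ = ±iζ`, `b, b′ ≥ 1`):                   `0 ≤ 2m + b − b′ ∧ (2m + b − b′)² ≥ b² + b′²`.

## The smear (MEMO-08 §4)
`m_ℓ := b·δ_ζ + B(s,b)·𝟙` on `μ₄`, `B(s,b) := s (s + 1 + b) / 2 = (d + Q/2)/4`; here `twoB s b = s (s + 1 + b) = 2B` and all
measures are DOUBLED so that everything is an integer.  THEOREM (T⁺) (§2 below): along every live pair the upper measure is
pointwise ≤ the lower one, and all measures are ≥ 0; `B(0,b) = 0` (top letters are pure Dirac, as in the PHASE-TORUS law);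
`B` is the least member of the class-expressible family `(x + yC + zQ − b)/4` with Dirac top letters (`x = 0, y = 1`) that is
monotone: `z = 1/2` is forced by the phase-creation pair `(h−2)·I → (h−1)I + ζ` (§3).

No `sorry`, no new axioms, no instances, no notation, no banned options.  Tactics: omega / nlinarith / norm_num / decide / ring.
-/

-- the summit's nested namespace `HodgeConjecture.HodgeConjecture` is flagged on every declaration (as in the Theorems files):
set_option linter.dupNamespace false

namespace Summit.HodgeConjecture.HodgeConjecture.Cruxes.BlochSeedDiscOne.StrengthenSmearedTransport

/-! ## §1 Causal (live) pairs of axial letters in deficit–modulus coordinates -/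

/-- The live (causal) conditions in deficit–modulus coordinates (lower `(s'+m, b)`, upper `(s', b')`, `m ≥ 0`) are written
INLINE below: same phase `b' ≤ b + m`; opposite phases / lower phase-less `b' ≤ m`; orthogonal phases
`0 ≤ 2m + b − b' ∧ b² + b'² ≤ (2m + b − b')²`.  They ARE the causal-cone condition `Δa ≥ |Δβ|` (`Δa = ΔC = 2m + b − b'`):
same phase, `|Δβ| = |b − b'|`: -/
theorem causalSame_iff (m b b' : ℤ) (hm : 0 ≤ m) :
    b' ≤ b + m ↔ |b - b'| ≤ 2 * m + b - b' := by
  constructor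
  · intro h
    rcases le_or_gt b' b with h1 | h1
    · rw [abs_of_nonneg (by omega)]; omega
    · rw [abs_of_neg (by omega)]; omega
  · intro h
    have := le_abs_self (b - b')
    have := neg_abs_le (b - b')
    omega

/-- opposite phases: `|Δβ| = b + b'`. -/
theorem causalOpp_iff (m b b' : ℤ) : b' ≤ m ↔ b + b' ≤ 2 * m + b - b' := by
  constructor <;> intro h <;> omega

/-- orthogonal phases: `|Δβ|² = b² + b'²`; the squared condition is equivalent to the bilinear bound
`b'(2m + b) ≤ 2m(m + b)` used in the proofs below. -/
theorem causalOrth_bilinear (m b b' : ℤ) :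
    b ^ 2 + b' ^ 2 ≤ (2 * m + b - b') ^ 2 ↔ b' * (2 * m + b) ≤ 2 * m * (m + b) := by
  constructor <;> intro h <;> nlinarith [h]

/-- along a live orthogonal pair with `b, b' ≥ 1` the deficit strictly drops: `m ≥ 1`. -/
theorem causalOrth_m_pos (m b b' : ℤ) (hb : 1 ≤ b) (hb' : 1 ≤ b')
    (h0 : 0 ≤ 2 * m + b - b') (h1 : b ^ 2 + b' ^ 2 ≤ (2 * m + b - b') ^ 2) : 1 ≤ m := by
  have h2 := (causalOrth_bilinear m b b').1 h1
  by_contra hcon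
  push Not at hcon
  have hm : m ≤ 0 := by omega
  nlinarith

/-- along a live orthogonal pair `b' ≤ b + m` as well (so the same-phase condition is the weakest of the three). -/
theorem causalOrth_le (m b b' : ℤ) (hm : 0 ≤ m) (hb : 0 ≤ b)
    (h0 : 0 ≤ 2 * m + b - b') (h1 : b ^ 2 + b' ^ 2 ≤ (2 * m + b - b') ^ 2) : b' ≤ b + m := by
  have h2 := (causalOrth_bilinear m b b').1 h1
  by_contra hcon
  push Not at hcon
  nlinarith

/-- TRIANGULARITY IN TOP (MEMO-08 §2(d)): a live pair never goes DOWN in top.  Lower letter on `LINE_t` with modulus `c`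
(`a = t − c`), upper on `LINE_{t'}` with modulus `c'`; `Δa = t' − t + c − c' ≥ |Δβ| ≥ |c − c'|` forces `t ≤ t'`. -/
theorem live_top_nondecreasing (t t' c c' : ℤ) (h : |c - c'| ≤ t' - t + c - c') : t ≤ t' := by
  have := le_abs_self (c - c')
  omega

/-- CROSS-TOP RULE, same phase (lower `(t − c, c ζ)`, upper `(t + 2 − c', c' ζ)`): live iff `c' ≤ c + 1`. -/
theorem crossTop_same (c c' : ℤ) : |c - c'| ≤ 2 + c - c' ↔ c' ≤ c + 1 := by
  constructor
  · intro h; have := neg_abs_le (c - c'); have := le_abs_self (c - c'); omega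
  · intro h
    rcases le_or_gt c' c with h1 | h1
    · rw [abs_of_nonneg (by omega)]; omega
    · rw [abs_of_neg (by omega)]; omega

/-- CROSS-TOP RULE, opposite phases: live iff `c' ≤ 1`. -/
theorem crossTop_opp (c c' : ℤ) : c + c' ≤ 2 + c - c' ↔ c' ≤ 1 := by
  constructor <;> intro h <;> omega

/-- CROSS-TOP RULE, orthogonal phases (`c ≥ 0`, `c' ≥ 0`): live iff `c' ≤ 1`. -/
theorem crossTop_orth (c c' : ℤ) (hc : 0 ≤ c) (hc' : 0 ≤ c') :
    (0 ≤ 2 + c - c' ∧ c ^ 2 + c' ^ 2 ≤ (2 + c - c') ^ 2) ↔ c' ≤ 1 := by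
  constructor
  · rintro ⟨h0, h1⟩
    by_contra hcon
    push Not at hcon
    nlinarith
  · intro h
    have h2 : c' = 0 ∨ c' = 1 := by omega
    rcases h2 with rfl | rfl <;> constructor <;> nlinarith

/-- NULL-INTERVAL DEGENERACY (= the PHASE-TORUS slide rule / floor-0 rigidity): if lower and upper letter are null-separated
in the same phase (`Δa = Δb = n > 0`, i.e. `m = 0`... here: `ΔC = b − b'' = n` with equal deficits) then every intermediate
letter of a live chain lower → mid → upper in the same phase has the same deficit and lies on the segment.  Arithmetic core:
with `m₁ + m₂ = 0`, `m₁, m₂ ≥ 0` both vanish. -/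
theorem null_chain_rigid (m₁ m₂ : ℤ) (h1 : 0 ≤ m₁) (h2 : 0 ≤ m₂) (h : m₁ + m₂ = 0) : m₁ = 0 ∧ m₂ = 0 := by
  constructor <;> omega

/-! ## §2 The monotone smear (T⁺) -/

/-- `twoB s b = 2·B(s,b) = s (s + 1 + b)`; the smear of the letter `(s, b, ζ)` is `m = b·δ_ζ + B·𝟙`. -/
def twoB (s b : ℤ) : ℤ := s * (s + 1 + b)

/-- top letters (`s = 0`) are pure Dirac: no smear. -/
theorem twoB_top (b : ℤ) : twoB 0 b = 0 := by unfold twoB; ring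

theorem twoB_nonneg (s b : ℤ) (hs : 0 ≤ s) (hb : 0 ≤ b) : 0 ≤ twoB s b := by
  unfold twoB; positivity

/-- CLASS-EXPRESSIBILITY: `4B = d + Q/2` with `d = 2s`, `Q = 4 s (s + b)`; hence the total mass of `m_ℓ` is
`b + 4B = C + Q/2` (`C = b + 2s`) and `m̂(±1) = β` (the uniform part has no first Fourier coefficient): the smeared design
measure has class-level Fourier coefficients on `{0, ±1}⁴`. -/
theorem fourB_eq (s b : ℤ) : 2 * twoB s b = 2 * s + (4 * s * (s + b)) / 2 := by
  unfold twoB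
  have : (4 * s * (s + b)) / 2 = 2 * s * (s + b) := by
    rw [show 4 * s * (s + b) = (2 * s * (s + b)) * 2 by ring]; simp
  rw [this]; ring

theorem mass_eq (s b : ℤ) : b + 2 * twoB s b = (b + 2 * s) + (4 * s * (s + b)) / 2 := by
  have := fourB_eq s b; omega

/-- (T⁺.0) OFF-PEAK / base monotonicity: along every live pair (`b' ≤ b + m` is implied by all three causal conditions)
the uniform part does not increase upward. -/
theorem mono_base (s' m b b' : ℤ) (hs : 0 ≤ s') (hm : 0 ≤ m) (hb : 0 ≤ b) (_hb' : 0 ≤ b')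
    (hc : b' ≤ b + m) : twoB s' b' ≤ twoB (s' + m) b := by
  unfold twoB; nlinarith [mul_le_mul_of_nonneg_left hc hs, mul_nonneg hm hb, mul_nonneg hm hs, mul_nonneg hm hm]

/-- (T⁺.1) SAME PHASE, at the common peak: `2b' + 2B' ≤ 2b + 2B`. -/
theorem mono_same_peak (s' m b b' : ℤ) (hs : 0 ≤ s') (hm : 0 ≤ m) (hb : 0 ≤ b) (_hb' : 0 ≤ b')
    (hc : b' ≤ b + m) : 2 * b' + twoB s' b' ≤ 2 * b + twoB (s' + m) b := by
  unfold twoB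
  rcases eq_or_lt_of_le hm with h0 | hpos
  · subst h0
    nlinarith [mul_le_mul_of_nonneg_left hc hs]
  · have h1 : 1 ≤ m := by omega
    nlinarith [mul_le_mul_of_nonneg_left hc hs, mul_le_mul_of_nonneg_left h1 hm, mul_nonneg hm hb, mul_nonneg hm hs]

/-- (T⁺.2) OPPOSITE PHASES (or lower letter phase-less), at the upper letter's peak: `2b' + 2B' ≤ 2B`. -/
theorem mono_opp_peak (s' m b b' : ℤ) (hs : 0 ≤ s') (hm : 0 ≤ m) (hb : 0 ≤ b) (hb' : 0 ≤ b')
    (hc : b' ≤ m) : 2 * b' + twoB s' b' ≤ twoB (s' + m) b := by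
  unfold twoB
  rcases eq_or_lt_of_le hm with h0 | hpos
  · subst h0
    have : b' = 0 := by omega
    subst this; nlinarith [mul_nonneg hs hb]
  · have h1 : 1 ≤ m := by omega
    have hbb : 0 ≤ m + b - b' := by omega
    nlinarith [mul_nonneg hs hbb, mul_le_mul_of_nonneg_left h1 hm, mul_nonneg hm hb, mul_nonneg hm hs]

/-- (T⁺.3) ORTHOGONAL PHASES (`b, b' ≥ 1`), at the upper letter's peak: `2b' + 2B' ≤ 2B`. -/
theorem mono_orth_peak (s' m b b' : ℤ) (hs : 0 ≤ s') (hm : 0 ≤ m) (hb : 1 ≤ b) (hb' : 1 ≤ b')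
    (hc0 : 0 ≤ 2 * m + b - b') (hc : b ^ 2 + b' ^ 2 ≤ (2 * m + b - b') ^ 2) :
    2 * b' + twoB s' b' ≤ twoB (s' + m) b := by
  have h1 : 1 ≤ m := causalOrth_m_pos m b b' hb hb' hc0 hc
  have hle : b' ≤ b + m := causalOrth_le m b b' hm (by omega) hc0 hc
  have h2 := (causalOrth_bilinear m b b').1 hc
  unfold twoB
  have hbb : 0 ≤ m + b - b' := by omega
  -- key: 2 b' ≤ m (m + 1 + b)
  have key : 2 * b' ≤ m * (m + 1 + b) := by
    rcases le_or_gt b' m with h3 | h3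
    · nlinarith [mul_le_mul_of_nonneg_left h1 hm, mul_nonneg hm (show 0 ≤ b by omega)]
    · -- b' > m: from the bilinear bound, b ≥ 2(b' − m) and (m − 1)(2b' − m) ≥ 0
      have h4 : 2 * m - b' ≤ m := by omega
      have h5 : 0 ≤ 2 * m - b' := by nlinarith
      have h6 : 2 * (b' - m) ≤ b := by nlinarith
      nlinarith [mul_nonneg (show 0 ≤ m - 1 by omega) (show 0 ≤ 2 * b' - m by omega)]
  nlinarith [mul_nonneg hs hbb, key]

/-- (T⁺.4) at the LOWER letter's own peak when phases differ the bound is the base one plus `2b ≥ 0` — recorded for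
completeness: `2B' ≤ 2b + 2B`. -/
theorem mono_lower_peak (s' m b b' : ℤ) (hs : 0 ≤ s') (hm : 0 ≤ m) (hb : 0 ≤ b) (hb' : 0 ≤ b')
    (hc : b' ≤ b + m) : twoB s' b' ≤ 2 * b + twoB (s' + m) b := by
  have := mono_base s' m b b' hs hm hb hb' hc; omega

/-- (T⁺) packaged: for every live pair, in all four positions of `μ₄` the doubled upper measure is ≤ the doubled lower
measure.  `peakLo u`/`peakUp u` say whether `u` is the phase of the lower/upper letter (a phase-less letter has no peak);
`rel` encodes the phase relation: 0 = same (or a phase-less letter), 1 = opposite/lower phase-less, 2 = orthogonal. -/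
theorem smear_monotone (s' m b b' : ℤ) (hs : 0 ≤ s') (hm : 0 ≤ m) (hb : 0 ≤ b) (hb' : 0 ≤ b')
    (peakLo peakUp : Bool) (rel : ℕ)
    (hrel : (rel = 0 ∧ b' ≤ b + m ∧ (peakUp = true → peakLo = true ∨ b' = 0)) ∨
            (rel = 1 ∧ b' ≤ m ∧ (peakUp = true → peakLo = false ∨ b = 0)) ∨
            (rel = 2 ∧ 1 ≤ b ∧ 1 ≤ b' ∧ (0 ≤ 2 * m + b - b' ∧ b ^ 2 + b' ^ 2 ≤ (2 * m + b - b') ^ 2) ∧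
              (peakUp = true → peakLo = false))) :
    (if peakUp then 2 * b' else 0) + twoB s' b' ≤ (if peakLo then 2 * b else 0) + twoB (s' + m) b := by
  have hle : b' ≤ b + m := by
    rcases hrel with ⟨_, h, _⟩ | ⟨_, h, _⟩ | ⟨_, hb1, _, h, _⟩
    · exact h
    · omega
    · exact causalOrth_le m b b' hm hb h.1 h.2
  have base := mono_base s' m b b' hs hm hb hb' hle
  rcases hrel with ⟨_, h, hp⟩ | ⟨_, h, hp⟩ | ⟨_, hb1, hb1', h, hp⟩
  · cases peakUp
    · cases peakLo <;> simp <;> nlinarith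
    · rcases hp rfl with hl | hz
      · subst hl; simp; exact mono_same_peak s' m b b' hs hm hb hb' h
      · subst hz; cases peakLo <;> simp <;> nlinarith
  · cases peakUp
    · cases peakLo <;> simp <;> nlinarith
    · have := mono_opp_peak s' m b b' hs hm hb hb' h
      cases peakLo <;> simp <;> nlinarith
  · cases peakUp
    · cases peakLo <;> simp <;> nlinarith
    · have := mono_orth_peak s' m b b' hs hm hb1 hb1' h.1 h.2
      have hl := hp rfl; subst hl; simpa using this

/-! ## §3 Minimality and the failure of the box smear -/

/-- PHASE CREATION forces `z ≥ 1/2`: for the live pair lower `(s,b) = (1,0)` (the letter `(h−2)·I`, `C = 2`, `Q = 4`) →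
upper top letter `(0, 1, ζ)` (Dirac mass 1 at `ζ`), a smear `B = (x + yC + zQ − b)/4` with Dirac tops (`x = 0`, `y = 1`)
needs `B(1,0) = (2 + 4z)/4 ≥ 1`, i.e. `8z ≥ 4` (in eighths, `z8 = 8z`). -/
theorem phase_creation_forces_half (z8 : ℤ) (h : 4 * 8 ≤ (0 + 8 * 2 + z8 * 4 - 0)) : 4 ≤ z8 := by omega

/-- … and `z = 1/2` gives exactly `B(1,0) = 1`: the bound is attained (`twoB 1 0 = 2`). -/
theorem phase_creation_tight : twoB 1 0 = 2 := by unfold twoB; ring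

/-- the BOX smear `B = d/4` (`2B = s`; `BandPhaseTorusBoxLaw.omegaB`) is NOT monotone: same pair, doubled units:
upper peak value `2·1 + 0 = 2` exceeds lower value `2B_box(1,0) = 1`. -/
theorem box_smear_not_monotone : ¬ ((2 : ℤ) * 1 + 0 ≤ 1) := by norm_num

/-- the bare Dirac measure (`B = 0`, PHASE-TORUS §14) fails at the same pair: `2 ≤ 0` is false. -/
theorem dirac_not_monotone_offline : ¬ ((2 : ℤ) * 1 + 0 ≤ 0) := by norm_num

/-! ## §4 Tensor monotonicity and the transport inequality (bookkeeping core of the laws L-MASS / L-DOWN / L-UP) -/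

/-- four-fold product of pointwise-dominated non-negative factors is dominated (per-cell form of `ω⁺ ≤ R`). -/
theorem tensor_mono4 (x₁ x₂ x₃ x₄ y₁ y₂ y₃ y₄ : ℤ)
    (h₁ : 0 ≤ y₁) (h₂ : 0 ≤ y₂) (h₃ : 0 ≤ y₃) (h₄ : 0 ≤ y₄)
    (g₁ : y₁ ≤ x₁) (g₂ : y₂ ≤ x₂) (g₃ : y₃ ≤ x₃) (g₄ : y₄ ≤ x₄) :
    y₁ * y₂ * y₃ * y₄ ≤ x₁ * x₂ * x₃ * x₄ := by
  have e1 : y₁ * y₂ ≤ x₁ * x₂ := mul_le_mul g₁ g₂ h₂ (le_trans h₁ g₁)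
  have e2 : y₃ * y₄ ≤ x₃ * x₄ := mul_le_mul g₃ g₄ h₄ (le_trans h₃ g₃)
  have p1 : 0 ≤ y₁ * y₂ := mul_nonneg h₁ h₂
  have p2 : 0 ≤ y₃ * y₄ := mul_nonneg h₃ h₄
  calc y₁ * y₂ * y₃ * y₄ = (y₁ * y₂) * (y₃ * y₄) := by ring
    _ ≤ (x₁ * x₂) * (x₃ * x₄) := mul_le_mul e1 e2 p2 (le_trans p1 e1)
    _ = x₁ * x₂ * x₃ * x₄ := by ring

/-- TRANSPORT INEQUALITY, one unit of flow (UP orientation): the value at a torus point of `ν = δ_N − δ_P` pushed through the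
smear is `W(N) − W(P) ≤ 0` when the N-cell lies above the P-cell factorwise; summing over a P-saturating flow gives
`ω⁺ = R − K`, `K ≥ 0` (MEMO-08 §4 (L)).  Here: the flow decomposition identity for totals, `ν·W = Σ r W(N) − Σ π (W(P) − W(N))`,
in its one-edge form. -/
theorem transport_edge (wN wP r : ℤ) (hflow : wN ≤ wP) :
    (r + 1) * wN - 1 * wP ≤ r * wN := by nlinarith

/-! ## §5 Law certificates on the designs of record (numbers from `eng/smear.json`, `eng/smear3.json`; model of record
`padclass.py` e162609f78d0a79c).  L-MASS (cleanliness-free Hall cut): an UP two-term design with a P-saturating letter-Hall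
flow and residual `γ` in `◇_h` satisfies `Σ_x ν(x) Π_f w(x_f) ≤ γ · (max w)⁴` for every causal-monotone `w ≥ 0`; with
`w = C` (`max = h`) resp. `w = C + Q/2` (`max = h + h²/2`). -/

/-- M72 design 1840bf6471a159f8 (BAND-4@12, rank 4): `Σν ΠC_f = 79 128 576 > 4·12⁴` — no UP letter-Hall flow
(consistent with monad-2 KILLHALL: two-term rank-4 dead). -/
theorem M72_Cmass_violates : (79128576 : ℤ) > 4 * 12 ^ 4 := by norm_num

/-- M72: smeared mass `M⁺ = Σν Π(C_f + Q_f/2) = 6 914 635 776 > 4·(12 + 72)⁴`. -/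
theorem M72_Mplus_violates : (6914635776 : ℤ) > 4 * (12 + 12 ^ 2 / 2) ^ 4 := by norm_num

/-- N46 design 9266fa35d78507d8 (h = 12, rank 4): `Σν ΠC_f = 8 404 992 > 4·12⁴` — no UP letter-Hall flow. -/
theorem N46_Cmass_violates : (8404992 : ℤ) > 4 * 12 ^ 4 := by norm_num

/-- № 46: smeared mass `M⁺ = 624 992 256 > 4·(12 + 72)⁴` (UPCUT-M⁺ also violated). -/
theorem N46_Mplus_violates : (624992256 : ℤ) > 4 * (12 + 12 ^ 2 / 2) ^ 4 := by norm_num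

/-- DOWNCUT-a (the `ι_h`-dual cut, weight `w = a` causal-isotone): a DOWN two-term letter-Hall design satisfies `γ₄ = Σν Πa_f ≤ γ₀·h⁴`.
M72 1840bf64: `γ₄ = 4 037 976 576 > 4·12⁴` — the rank-4 CLASS of M72 has no DOWN presentation either (any axial support in ◇₁₂). -/
theorem M72_amass_violates : (4037976576 : ℤ) > 4 * 12 ^ 4 := by norm_num

/-- № 46 9266fa35: `γ₄ = 305 197 056 > 4·12⁴` — no DOWN presentation. -/
theorem N46_amass_violates : (305197056 : ℤ) > 4 * 12 ^ 4 := by norm_num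

/-- № 53+hub 738b57ce (rank 12): `γ₄ = 18 395 136 > 12·12⁴ = 248 832` — no DOWN presentation (UP cuts pass). -/
theorem No53hub_amass_violates : (18395136 : ℤ) > 12 * 12 ^ 4 := by norm_num

/-- S′ design ac808a66f59a2092 (TRUE LINE-14, rank 4): on the LINE `C = b`, `Q = 0`, so `M⁺ = Σν Πb_f = 0` by (A1) —
the PHASE-TORUS moment identity (M) is the `s = 0` face of the smeared one.  Arithmetic core: `Q = 4·0·(0+b) = 0`. -/
theorem line_Q_zero (b : ℤ) : 4 * 0 * (0 + b) = 0 := by ring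

/-! ## §6 ERRATUM E7-1 support: the TRUE LINE alphabet.  `LINE_h = {(h − c, c·ζ)}` (`a + |β| = h`), NOT `{(h − 2r, r·ζ)}`.
On the true LINE the `p`-coordinate is AFFINE in `c` — whence `Λ(LINE_h⁴)` has rank 4, not 5. -/

/-- `a² − |β|² = h² − 2hc` on the true LINE: affine in `c`. -/
theorem trueLine_p_affine (h c : ℤ) : (h - c) ^ 2 - c ^ 2 = h * h - 2 * h * c := by ring

/-- on g4's fictitious alphabet `(h − 2r, r)` the `p`-coordinate `(h−2r)² − r² = h² − 4hr + 3r²` is genuinely quadratic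
(coefficient 3 of `r²`): the source of the spurious rank 5 and of every «3-adic» law of MEMO-07 §2ter/§2quater. -/
theorem fakeLine_p_quadratic (h r : ℤ) : (h - 2 * r) ^ 2 - r ^ 2 = h * h - 4 * h * r + 3 * r ^ 2 := by ring

/-- the HNF rows of `Λ(LINE_h⁴)` found for h = 8 … 20 (`eng/true-line.json`): `λ_d = h^{d−1} (d·λ₁ − (d−1)·h·λ₀)`;
certificate that the h = 14 rows `(1, 0, −196, −5488, −115248, …)` and `(0, 2, 56, 1176, 21952, …)` fit the closed form
(`λ₀ = 1, λ₁ = 0` resp. `λ₀ = 0, λ₁ = 2`). -/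
theorem trueLine_rows_h14 :
    ((-196 : ℤ) = 14 ^ 1 * (2 * 0 - 1 * 14 * 1) ∧ (-5488 : ℤ) = 14 ^ 2 * (3 * 0 - 2 * 14 * 1) ∧
      (-115248 : ℤ) = 14 ^ 3 * (4 * 0 - 3 * 14 * 1)) ∧
    ((56 : ℤ) = 14 ^ 1 * (2 * 2 - 1 * 14 * 0) ∧ (1176 : ℤ) = 14 ^ 2 * (3 * 2 - 2 * 14 * 0) ∧
      (21952 : ℤ) = 14 ^ 3 * (4 * 2 - 3 * 14 * 0)) := by norm_num

end Summit.HodgeConjecture.HodgeConjecture.Cruxes.BlochSeedDiscOne.StrengthenSmearedTransport
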